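/-
Copyright (c) 2026 the pub-hodgecm-mathlib formalisation cell (harness21).  Prover seat hodgecm-mathlib-K2Liu-p14 (g2), Track B «K2-LIT»,
#184♮ = hLiu418 = `stmt-HodgeConjecture-24832`; socket #42S organ S2 («ARCH SPAN BY K-TYPE PATHS»), S2-asm FILE 1 (LEAD F0P6-plan (g14) BATCH #18 (1) «(α′) = p14»;
K2Liu-ref1 (g5) by-value table 12:57:48Z; ★ S2-P PARTS A–D (K2E5-p16 (g6)), ★ S2-K DEFS∕K-3 (K2Liu-p10 (g4))).
-/
import Summits.HodgeConjecture.HodgeConjecture.Theorems.K2LiuU22CompactPictureRootTypes       -- ★ S2-P PART D: `denom_kU_cayley_conj`, `conj_trace_mul_conjTranspose` (+ PARTS A–C)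
import Summits.HodgeConjecture.HodgeConjecture.Theorems.K2LiuU22CompactPictureChainRule       -- ★ S2-K K-3: `hasDerivAt_evalAt` (+ DEFS: `Carrier`, `evalAt`, `pOp`, `mOp`, `lOp`, `rOp`, `pd`)
import Summits.HodgeConjecture.HodgeConjecture.Theorems.K2LiuLieRayDifferentiability         -- ★ `conjTranspose_exp_mul_J_mul_exp` (`exp(t𝔲(J)) ⊆ U(J)`)
import HarnessLib

/-!
# Crux `HLiu418`, organ S2, S2-asm FILE 1: THE COMPACT-PICTURE OPERATOR DICTIONARY — the analytic Lie derivative of a Siegel section at a compact-picture point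
# (S2-P: multiplier `(m∕2−k)τ_X + (m∕2)conj τ_{θX}`, field `V_X`) IS the evaluation of S2-K's FORMAL operator `Op_X = Σ β·P_{ab}(p) + Σ γ·M_{ab}(q) + κ tr α − Σ α·L_{ab} + Σ δ·R_{ab}`

Cell `hodgecm-mathlib`, crux item hLiu418 = `stmt-HodgeConjecture-24832`; squad K2 ∕ K2Liu; prover K2Liu-p14 (g2).  THEOREMS ONLY (no `def`, no instance, no
notation, no named-fact hypothesis, no `sorry`); lane `--supports stmt-HodgeConjecture-24832 --as helper`.  Rank `l = Fin 2` (the S2-K carrier is `2 × 2`).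

LETTERS.  Tube frame (★ D∞): `U(J)`, `k_u = C·diag(1,u)·C′ = ½((1+u), −i(1−u); i(1−u), (1+u))` (★ PART A), Cayley pair `C = (1 1; i·1 −i·1)`, `C′ = ½(1 −i·1; 1 i·1)`,
generator `X = C·(α β; γ δ)·C′`, `θX := J Xᴴ J`; S2-K carrier `𝒜 = Carrier = ℂ[u_{ij}, D⁻¹]` with `evalAt u hu : 𝒜 →ₐ ℂ`, derivations `pd i j`, operators `pOp pd uMat dInv p a b`,
`mOp pd uMat q a b`, `lOp∕rOp pd uMat a b` (★ DEFS p860097).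
* §1 `evalAt_adjugate_uMat`, **`evalAt_pOp`**, **`evalAt_mOp`**, **`evalAt_lOp`**, **`evalAt_rOp`** — the four formal operators evaluated at an invertible point;
* §2 `J_mul_cayley`, `cayleyInv_mul_J`, **`theta_cayley`** (`θ(C M C′) = C·(−αᴴ γᴴ; βᴴ −δᴴ)·C′`), and at a point `u`: `τ_X(u) = tr α − tr(uγ)`, `τ_{θX}(u) = −tr αᴴ − tr(u βᴴ)`,
  `conj τ_{θX}(u) = −tr α − tr(β uᴴ)` (★ `denom_kU_cayley_conj`, ★ `conj_trace_mul_conjTranspose`);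
* §3 **`dictionary_identity`** — at a unitary point `u` (`uᴴu = 1`), for every `P ∈ 𝒜` and every complex block quadruple `(α β γ δ)`:
  `((m∕2−k)·τ_X(u) + (m∕2)·conj τ_{θX}(u))·ev_u P + Σ_{ij} (V_X u)_{ij}·ev_u(pd i j P) = ev_u (Op_X P)`, `Op_X P = Σ β_{ab}•pOp p a b P + Σ γ_{ab}•mOp q a b P + (κ tr α)•P
  − Σ α_{ab}•lOp a b P + Σ δ_{ab}•rOp a b P`, **`p = −m∕2`, `q = k − m∕2`, `κ = −k`** (with PART C's `m = k − 2s − 2`: `p = s+1+κ∕2`, `q = s+1−κ∕2` — ref1 PREP-S2 §1 ✓);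
* §4 **`hasDerivAt_section_kU_exp_evalAt`** — for REAL `X = C M C′ ∈ 𝔲(J)` and `A ∈ I_w(s, χ_k)` whose compact picture is `P` (`A(k_v) = ev_v P` on `U(2)`):
  `d∕dt|₀ A(k_u·exp tX) = ev_u(Op_X P)` (★ PART C `hasDerivAt_section_kU_exp`, its `hG` discharged by ★ K-3 `hasDerivAt_evalAt` along ★ `hasDerivAt_shilov_kU_exp_entry`,
  `det v_t ≠ 0` by ★ Shilov unitarity; `θX = X` by ★ `J_mul_conjTranspose_mul_J_of_mem`).  Complex `X` (σ14): §3 + ★ `multiplier_complexified`∕`velocity_complexified`.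
References: [Knapp1986, Ch. VII §1, VIII §3]; [LeeZhu1998, p. 5032]; [KashiwaraVergne1978, §II.5]; K2Liu-ref1 PREP-S2 §1.
HONEST LABEL.  Count-neutral helper: `HC_CM` is proved only modulo the 7 printed citations (2 remaining named inputs: hLiu418 = `stmt-HodgeConjecture-24832`,
h413 = `stmt-HodgeConjecture-24833`) until rung 0 closes.
-/

set_option autoImplicit false
set_option linter.dupNamespace false -- the mandated namespace repeats `HodgeConjecture.HodgeConjecture`

noncomputable section

open Complex Matrix NormedSpace
open scoped ComplexConjugate

namespace Summit.HodgeConjecture.HodgeConjecture.Cruxes.HLiu418.K2LiuU22CompactPictureOperatorDictionary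

open Literature.NumberTheory.ModularForms.SiegelUpperHalfSpace (num denom moeb num_def denom_def moeb_def num_fromBlocks denom_fromBlocks)
open Summit.HodgeConjecture.HodgeConjecture.Cruxes.HLiu418.K2LiuHermitianTubeCocycle
open Summit.HodgeConjecture.HodgeConjecture.Cruxes.HLiu418.K2LiuHermitianTubeFramePMinus
open Summit.HodgeConjecture.HodgeConjecture.Cruxes.HLiu418.K2LiuArchInducedTubeDefs
open Summit.HodgeConjecture.HodgeConjecture.Cruxes.HLiu418.K2LiuU22ShilovCoordinate
open Summit.HodgeConjecture.HodgeConjecture.Cruxes.HLiu418.K2LiuLieRayDifferentiability (conjTranspose_exp_mul_J_mul_exp)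
open Summit.HodgeConjecture.HodgeConjecture.Cruxes.HLiu418.K2LiuU22CompactPicturePOperatorsExp
open Summit.HodgeConjecture.HodgeConjecture.Cruxes.HLiu418.K2LiuU22CompactPictureRootTypes
open Summit.HodgeConjecture.HodgeConjecture.Cruxes.HLiu418.K2LiuU22CompactPictureDefs
open Summit.HodgeConjecture.HodgeConjecture.Cruxes.HLiu418.K2LiuU22CompactPictureChainRule

/-! ## §1 The four formal operators evaluated at an invertible point -/

section Eval

variable (g : Matrix (Fin 2) (Fin 2) ℂ) (hg : g.det ≠ 0)

/-- `ev_g` maps the generic matrix `uMat` to `g`. [folklore] -/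
theorem mapMatrix_evalAt_uMat : (evalAt g hg).toRingHom.mapMatrix uMat = g := by
  ext i j
  exact evalAt_uMat g hg i j

/-- `ev_g (adj(uMat)_{ij}) = adj(g)_{ij}` (`adj` commutes with ring homomorphisms). [folklore] -/
theorem evalAt_adjugate_uMat (i j : Fin 2) : evalAt g hg (uMat.adjugate i j) = g.adjugate i j := by
  have h := RingHom.map_adjugate (evalAt g hg).toRingHom uMat
  rw [mapMatrix_evalAt_uMat] at h
  have hij := congrFun (congrFun h i) j
  rw [RingHom.mapMatrix_apply, Matrix.map_apply] at hij
  exact hij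

/-- **`ev_g (P_{ab} F) = p·(det g)⁻¹·adj(g)_{ba}·ev_g F − ev_g (∂_{ab} F)`** (★ `pOp_apply`). [cite: LeeZhu1998, p. 5032] -/
theorem evalAt_pOp (p : ℂ) (a b : Fin 2) (F : Carrier) :
    evalAt g hg (pOp pd uMat dInv p a b F) = p * ((g.det)⁻¹ * g.adjugate b a * evalAt g hg F) - evalAt g hg (pd a b F) := by
  rw [pOp_apply, map_sub, map_smul, map_mul, map_mul, evalAt_dInv, evalAt_adjugate_uMat, smul_eq_mul]

/-- **`ev_g (M_{ab} F) = q·g_{ba}·ev_g F + Σ_{ij} g_{ia} g_{bj} ev_g (∂_{ij} F)`** (★ `mOp_apply`). [cite: LeeZhu1998, p. 5032] -/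
theorem evalAt_mOp (q : ℂ) (a b : Fin 2) (F : Carrier) :
    evalAt g hg (mOp pd uMat q a b F) = q * (g b a * evalAt g hg F) + ∑ i : Fin 2, ∑ j : Fin 2, g i a * g b j * evalAt g hg (pd i j F) := by
  rw [mOp_apply, map_add, map_smul, map_mul, evalAt_uMat, smul_eq_mul, map_sum]
  congr 1
  refine Finset.sum_congr rfl fun i _ => ?_
  rw [map_sum]
  refine Finset.sum_congr rfl fun j _ => ?_
  rw [map_mul, map_mul, evalAt_uMat, evalAt_uMat]

/-- **`ev_g (L_{ab} F) = Σ_k g_{bk} ev_g (∂_{ak} F)`** (★ `lOp_apply`). [cite: KashiwaraVergne1978, §II.5] -/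
theorem evalAt_lOp (a b : Fin 2) (F : Carrier) :
    evalAt g hg (lOp pd uMat a b F) = ∑ k : Fin 2, g b k * evalAt g hg (pd a k F) := by
  rw [lOp_apply, map_sum]
  refine Finset.sum_congr rfl fun k _ => ?_
  rw [map_mul, evalAt_uMat]

/-- **`ev_g (R_{ab} F) = Σ_k g_{ka} ev_g (∂_{kb} F)`** (★ `rOp_apply`). [cite: KashiwaraVergne1978, §II.5] -/
theorem evalAt_rOp (a b : Fin 2) (F : Carrier) :
    evalAt g hg (rOp pd uMat a b F) = ∑ k : Fin 2, g k a * evalAt g hg (pd k b F) := by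
  rw [rOp_apply, map_sum]
  refine Finset.sum_congr rfl fun k _ => ?_
  rw [map_mul, evalAt_uMat]

end Eval

/-! ## §2 The conjugation `θ` on Cayley-frame generators and the two traces -/

section Theta

variable {l : Type*} [Fintype l] [DecidableEq l]

/-- `J·C = (−i)·(C·Q)`, `Q = diag(1,−1)`. [cite: Knapp1986, Ch. VI §2] -/
theorem J_mul_cayley :
    Matrix.J l ℂ * (fromBlocks 1 1 (I • 1) (-(I • 1)) : Matrix (l ⊕ l) (l ⊕ l) ℂ) =
      (-I) • ((fromBlocks 1 1 (I • 1) (-(I • 1)) : Matrix (l ⊕ l) (l ⊕ l) ℂ) * fromBlocks 1 0 0 (-1)) := by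
  rw [Matrix.J, fromBlocks_multiply, fromBlocks_multiply, fromBlocks_smul]
  simp only [Matrix.zero_mul, Matrix.one_mul, Matrix.mul_one, Matrix.mul_zero, Matrix.mul_neg, zero_add, add_zero, smul_neg, neg_zero,
    smul_smul, I_mul_I, neg_smul, neg_neg, one_smul, neg_mul]

/-- `C′·J = (−i)·(Q·C′)`. [cite: Knapp1986, Ch. VI §2] -/
theorem cayleyInv_mul_J :
    ((2 : ℂ)⁻¹ • fromBlocks 1 (-(I • 1)) 1 (I • 1) : Matrix (l ⊕ l) (l ⊕ l) ℂ) * Matrix.J l ℂ =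
      (-I) • (fromBlocks 1 0 0 (-1) * ((2 : ℂ)⁻¹ • fromBlocks 1 (-(I • 1)) 1 (I • 1) : Matrix (l ⊕ l) (l ⊕ l) ℂ)) := by
  rw [Matrix.J, Matrix.smul_mul, Matrix.mul_smul, smul_comm, fromBlocks_multiply, fromBlocks_multiply, fromBlocks_smul, fromBlocks_smul, fromBlocks_smul]
  simp only [Matrix.zero_mul, Matrix.one_mul, Matrix.mul_one, Matrix.mul_zero, zero_add, add_zero, smul_neg,
    smul_smul, I_mul_I, neg_smul, neg_neg, one_smul, mul_neg, neg_mul, neg_zero]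

/-- `(C M C′)ᴴ = C Mᴴ C′` (`Cᴴ = 2C′`, `C′ᴴ = ½C`). [cite: Knapp1986, Ch. VI §2] -/
theorem conjTranspose_cayley (M : Matrix (l ⊕ l) (l ⊕ l) ℂ) :
    (fromBlocks 1 1 (I • 1) (-(I • 1)) * M * ((2 : ℂ)⁻¹ • fromBlocks 1 (-(I • 1)) 1 (I • 1)) : Matrix (l ⊕ l) (l ⊕ l) ℂ)ᴴ =
      fromBlocks 1 1 (I • 1) (-(I • 1)) * Mᴴ * ((2 : ℂ)⁻¹ • fromBlocks 1 (-(I • 1)) 1 (I • 1)) := by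
  have hC : (fromBlocks 1 1 (I • 1) (-(I • 1)) : Matrix (l ⊕ l) (l ⊕ l) ℂ)ᴴ = fromBlocks 1 (-(I • 1)) 1 (I • 1) := by
    rw [fromBlocks_conjTranspose, conjTranspose_one, conjTranspose_neg, conjTranspose_smul, conjTranspose_one, Complex.star_def, conj_I, neg_smul, neg_neg]
  have hC' : (fromBlocks 1 (-(I • 1)) 1 (I • 1) : Matrix (l ⊕ l) (l ⊕ l) ℂ)ᴴ = fromBlocks 1 1 (I • 1) (-(I • 1)) := by
    rw [fromBlocks_conjTranspose, conjTranspose_one, conjTranspose_neg, conjTranspose_smul, conjTranspose_one, Complex.star_def, conj_I, neg_smul, neg_neg]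
  rw [conjTranspose_mul, conjTranspose_mul, conjTranspose_smul, hC, hC', Complex.star_def, map_inv₀, map_ofNat]
  simp only [Matrix.smul_mul, Matrix.mul_smul, Matrix.mul_assoc]

/-- **`θ(C M C′) = C·θ₀(M)·C′`** with `θ₀(α β; γ δ) = (−αᴴ γᴴ; βᴴ −δᴴ)` (`θ₀M = −Q Mᴴ Q`, the involution fixing `𝔲(1,−1)`). [cite: Knapp1986, Ch. VI §2] -/
theorem theta_cayley (α β γ δ : Matrix l l ℂ) :
    Matrix.J l ℂ * (fromBlocks 1 1 (I • 1) (-(I • 1)) * fromBlocks α β γ δ * ((2 : ℂ)⁻¹ • fromBlocks 1 (-(I • 1)) 1 (I • 1)) : Matrix (l ⊕ l) (l ⊕ l) ℂ)ᴴ *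
        Matrix.J l ℂ =
      fromBlocks 1 1 (I • 1) (-(I • 1)) * fromBlocks (-αᴴ) γᴴ βᴴ (-δᴴ) * ((2 : ℂ)⁻¹ • fromBlocks 1 (-(I • 1)) 1 (I • 1)) := by
  rw [conjTranspose_cayley]
  have hθ₀ : (fromBlocks 1 0 0 (-1) : Matrix (l ⊕ l) (l ⊕ l) ℂ) * (fromBlocks α β γ δ)ᴴ * fromBlocks 1 0 0 (-1) = fromBlocks αᴴ (-γᴴ) (-βᴴ) δᴴ := by
    rw [fromBlocks_conjTranspose, fromBlocks_multiply, fromBlocks_multiply]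
    simp only [Matrix.one_mul, Matrix.mul_one, Matrix.zero_mul, Matrix.mul_zero, add_zero, zero_add, Matrix.neg_mul, Matrix.mul_neg, neg_neg]
  calc Matrix.J l ℂ * (fromBlocks 1 1 (I • 1) (-(I • 1)) * (fromBlocks α β γ δ)ᴴ * ((2 : ℂ)⁻¹ • fromBlocks 1 (-(I • 1)) 1 (I • 1))) * Matrix.J l ℂ
      = (Matrix.J l ℂ * fromBlocks 1 1 (I • 1) (-(I • 1))) * (fromBlocks α β γ δ)ᴴ * (((2 : ℂ)⁻¹ • fromBlocks 1 (-(I • 1)) 1 (I • 1)) * Matrix.J l ℂ) := by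
        simp only [Matrix.mul_assoc]
    _ = fromBlocks 1 1 (I • 1) (-(I • 1)) * (-(fromBlocks 1 0 0 (-1) * (fromBlocks α β γ δ)ᴴ * fromBlocks 1 0 0 (-1))) *
          ((2 : ℂ)⁻¹ • fromBlocks 1 (-(I • 1)) 1 (I • 1)) := by
        rw [J_mul_cayley, cayleyInv_mul_J, Matrix.smul_mul, Matrix.smul_mul, Matrix.mul_smul, smul_smul, show (-I) * (-I) = (-1 : ℂ) by rw [neg_mul_neg, I_mul_I],
          neg_one_smul, Matrix.mul_neg, Matrix.neg_mul]
        simp only [Matrix.mul_assoc]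
    _ = _ := by
        rw [hθ₀, fromBlocks_neg, neg_neg, neg_neg]

end Theta

/-- **`τ_X(u) = tr α − tr(uγ)`** and **`conj τ_{θX}(u) = −tr α − tr(β uᴴ)`** for `X = C·(α β; γ δ)·C′` (★ `denom_kU_cayley_conj`, `theta_cayley`). [cite: LeeZhu1998, p. 5032] -/
theorem trace_denom_kU_cayley (u α β γ δ : Matrix (Fin 2) (Fin 2) ℂ) :
    (denom (((2 : ℂ)⁻¹ • fromBlocks (1 + u) (-(I • (1 - u))) (I • (1 - u)) (1 + u) : Matrix (Fin 2 ⊕ Fin 2) (Fin 2 ⊕ Fin 2) ℂ) *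
          (fromBlocks 1 1 (I • 1) (-(I • 1)) * fromBlocks α β γ δ * ((2 : ℂ)⁻¹ • fromBlocks 1 (-(I • 1)) 1 (I • 1)))) (-(I • (1 : Matrix (Fin 2) (Fin 2) ℂ)))).trace =
        α.trace - (u * γ).trace ∧
      conj (denom (((2 : ℂ)⁻¹ • fromBlocks (1 + u) (-(I • (1 - u))) (I • (1 - u)) (1 + u) : Matrix (Fin 2 ⊕ Fin 2) (Fin 2 ⊕ Fin 2) ℂ) *
          (Matrix.J (Fin 2) ℂ * (fromBlocks 1 1 (I • 1) (-(I • 1)) * fromBlocks α β γ δ * ((2 : ℂ)⁻¹ • fromBlocks 1 (-(I • 1)) 1 (I • 1)))ᴴ * Matrix.J (Fin 2) ℂ))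
          (-(I • (1 : Matrix (Fin 2) (Fin 2) ℂ)))).trace = -α.trace - (β * uᴴ).trace := by
  constructor
  · rw [(denom_kU_cayley_conj u α β γ δ).2, trace_sub]
  · rw [theta_cayley, (denom_kU_cayley_conj u (-αᴴ) γᴴ βᴴ (-δᴴ)).2, trace_sub, trace_neg, map_sub, map_neg, Matrix.trace_conjTranspose,
      Complex.star_def, Complex.conj_conj, conj_trace_mul_conjTranspose]

/-! ## §3 The dictionary identity at a unitary point -/

/-- on `U(2)`: `uᴴ = (det u)⁻¹ · adj(u)`. [folklore] -/
theorem conjTranspose_eq_det_inv_smul_adjugate {u : Matrix (Fin 2) (Fin 2) ℂ} (hu : uᴴ * u = 1) : uᴴ = (u.det)⁻¹ • u.adjugate := by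
  rw [← Matrix.inv_eq_left_inv hu, Matrix.inv_def, Ring.inverse_eq_inv]

/-- **THE DICTIONARY IDENTITY (block form)** at a unitary point `u`: with the analytic data of `X = C·(α β; γ δ)·C′` — `τ_X(u) = tr α − tr(uγ)`,
`conj τ_{θX}(u) = −tr α − tr(βuᴴ)`, `V_X(u) = uδ − β − αu + uγu` — and ANY multiplier coefficients `m₀, k₀` (PART C: `m₀ = m∕2 − k`, `k₀ = m∕2`):
`(m₀ τ_X + k₀ conj τ_{θX})·ev P + Σ_{ij} (V_X)_{ij} ev(∂_{ij}P) = ev(Op_X P)`, `Op_X = Σ β_{ab} P_{ab}(p) + Σ γ_{ab} M_{ab}(q) + κ·tr α − Σ α_{ab} L_{ab} + Σ δ_{ab} R_{ab}` with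
**`p = −k₀`, `q = −m₀`, `κ = m₀ − k₀`** (= `s+1+κ∕2`, `s+1−κ∕2`, `−k`). [cite: LeeZhu1998, p. 5032] [cite: Knapp1986, Ch. VIII §3] -/
theorem dictionary_identity_blocks (m₀ k₀ : ℂ) {u : Matrix (Fin 2) (Fin 2) ℂ} (hu : uᴴ * u = 1) (hu' : u.det ≠ 0) (α β γ δ : Matrix (Fin 2) (Fin 2) ℂ)
    (P : Carrier) :
    (m₀ * (α.trace - (u * γ).trace) + k₀ * (-α.trace - (β * uᴴ).trace)) * evalAt u hu' P +
        ∑ i : Fin 2, ∑ j : Fin 2, (u * δ - β - α * u + u * γ * u) i j * evalAt u hu' (pd i j P) =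
      evalAt u hu' (∑ a : Fin 2, ∑ b : Fin 2, β a b • pOp pd uMat dInv (-k₀) a b P + ∑ a : Fin 2, ∑ b : Fin 2, γ a b • mOp pd uMat (-m₀) a b P +
        ((m₀ - k₀) * α.trace) • P - ∑ a : Fin 2, ∑ b : Fin 2, α a b • lOp pd uMat a b P + ∑ a : Fin 2, ∑ b : Fin 2, δ a b • rOp pd uMat a b P) := by
  rw [conjTranspose_eq_det_inv_smul_adjugate hu]
  simp only [map_add, map_sub, map_smul, smul_eq_mul, evalAt_pOp, evalAt_mOp, evalAt_lOp, evalAt_rOp, Matrix.trace_fin_two,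
    Matrix.mul_apply, Matrix.smul_apply, Matrix.add_apply, Matrix.sub_apply, Fin.sum_univ_two]
  ring

/-- **THE DICTIONARY IDENTITY (S2-P letters)**: the same with the left-hand side LITERALLY the multiplier∕velocity of ★ PART C∕D — `τ_X = tr denom (k_u X) (−i1)`,
`τ_{θX}` with `θX = J Xᴴ J`, `V_X = denom (k_u X) (i1) − denom (k_u X) (−i1)·u` — for `X = C·(α β; γ δ)·C′`. [cite: LeeZhu1998, p. 5032] [cite: Knapp1986, Ch. VIII §3] -/
theorem dictionary_identity (m₀ k₀ : ℂ) {u : Matrix (Fin 2) (Fin 2) ℂ} (hu : uᴴ * u = 1) (hu' : u.det ≠ 0) (α β γ δ : Matrix (Fin 2) (Fin 2) ℂ)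
    (P : Carrier) :
    (m₀ * (denom (((2 : ℂ)⁻¹ • fromBlocks (1 + u) (-(I • (1 - u))) (I • (1 - u)) (1 + u) : Matrix (Fin 2 ⊕ Fin 2) (Fin 2 ⊕ Fin 2) ℂ) *
            (fromBlocks 1 1 (I • 1) (-(I • 1)) * fromBlocks α β γ δ * ((2 : ℂ)⁻¹ • fromBlocks 1 (-(I • 1)) 1 (I • 1)))) (-(I • (1 : Matrix (Fin 2) (Fin 2) ℂ)))).trace +
        k₀ * conj (denom (((2 : ℂ)⁻¹ • fromBlocks (1 + u) (-(I • (1 - u))) (I • (1 - u)) (1 + u) : Matrix (Fin 2 ⊕ Fin 2) (Fin 2 ⊕ Fin 2) ℂ) *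
            (Matrix.J (Fin 2) ℂ * (fromBlocks 1 1 (I • 1) (-(I • 1)) * fromBlocks α β γ δ * ((2 : ℂ)⁻¹ • fromBlocks 1 (-(I • 1)) 1 (I • 1)))ᴴ * Matrix.J (Fin 2) ℂ))
            (-(I • (1 : Matrix (Fin 2) (Fin 2) ℂ)))).trace) * evalAt u hu' P +
        ∑ i : Fin 2, ∑ j : Fin 2,
          (denom (((2 : ℂ)⁻¹ • fromBlocks (1 + u) (-(I • (1 - u))) (I • (1 - u)) (1 + u) : Matrix (Fin 2 ⊕ Fin 2) (Fin 2 ⊕ Fin 2) ℂ) *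
                (fromBlocks 1 1 (I • 1) (-(I • 1)) * fromBlocks α β γ δ * ((2 : ℂ)⁻¹ • fromBlocks 1 (-(I • 1)) 1 (I • 1)))) (I • (1 : Matrix (Fin 2) (Fin 2) ℂ)) -
              denom (((2 : ℂ)⁻¹ • fromBlocks (1 + u) (-(I • (1 - u))) (I • (1 - u)) (1 + u) : Matrix (Fin 2 ⊕ Fin 2) (Fin 2 ⊕ Fin 2) ℂ) *
                (fromBlocks 1 1 (I • 1) (-(I • 1)) * fromBlocks α β γ δ * ((2 : ℂ)⁻¹ • fromBlocks 1 (-(I • 1)) 1 (I • 1)))) (-(I • (1 : Matrix (Fin 2) (Fin 2) ℂ))) * u)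
            i j * evalAt u hu' (pd i j P) =
      evalAt u hu' (∑ a : Fin 2, ∑ b : Fin 2, β a b • pOp pd uMat dInv (-k₀) a b P + ∑ a : Fin 2, ∑ b : Fin 2, γ a b • mOp pd uMat (-m₀) a b P +
        ((m₀ - k₀) * α.trace) • P - ∑ a : Fin 2, ∑ b : Fin 2, α a b • lOp pd uMat a b P + ∑ a : Fin 2, ∑ b : Fin 2, δ a b • rOp pd uMat a b P) := by
  obtain ⟨hτ, hθ⟩ := trace_denom_kU_cayley u α β γ δ
  obtain ⟨hWp, hWm⟩ := denom_kU_cayley_conj u α β γ δ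
  rw [hτ, hθ, hWp, hWm, show u * δ - β - (α - u * γ) * u = u * δ - β - α * u + u * γ * u by rw [Matrix.sub_mul]; abel]
  exact dictionary_identity_blocks m₀ k₀ hu hu' α β γ δ P

/-! ## §4 The real corollary: `d∕dt|₀ A(k_u·exp tX) = ev_u (Op_X P)` for `X ∈ 𝔲(J)` -/

/-- **THE ANALYTIC LIE DERIVATIVE IS THE FORMAL OPERATOR** (real generators): let `A ∈ I_w(s, χ_k)` have compact picture `P ∈ 𝒜 = ℂ[u, D⁻¹]` (`A(k_v) = ev_v P` for
unitary `v`), let `X = C·(α β; γ δ)·C′ ∈ 𝔲(J)` and `u` unitary.  Then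
`d∕dt|₀ A(k_u · exp(tX)) = ev_u (Σ β_{ab} P_{ab}(p) P + Σ γ_{ab} M_{ab}(q) P + (κ tr α) P − Σ α_{ab} L_{ab} P + Σ δ_{ab} R_{ab} P)` with `m = k − 2s − 2`, `p = −m∕2`, `q = k − m∕2`,
`κ = −k` (★ PART C `hasDerivAt_section_kU_exp`; its `hG` = ★ K-3 `hasDerivAt_evalAt` along ★ `hasDerivAt_shilov_kU_exp_entry`; `θX = X`). [cite: Knapp1986, Ch. VIII §3]
[cite: LeeZhu1998, p. 5032] -/
theorem hasDerivAt_section_kU_exp_evalAt (k : ℤ) (s : ℂ) {A : Matrix (Fin 2 ⊕ Fin 2) (Fin 2 ⊕ Fin 2) ℂ → ℂ}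
    (hA : IsArchSiegelSection (fun z : ℂ => (conj z / ((‖z‖ : ℝ) : ℂ)) ^ k) s A) (P : Carrier)
    (hAP : ∀ (v : Matrix (Fin 2) (Fin 2) ℂ), vᴴ * v = 1 → ∀ hv : v.det ≠ 0,
      A ((2 : ℂ)⁻¹ • fromBlocks (1 + v) (-(I • (1 - v))) (I • (1 - v)) (1 + v)) = evalAt v hv P)
    {u : Matrix (Fin 2) (Fin 2) ℂ} (hu : uᴴ * u = 1) (hu' : u.det ≠ 0) (α β γ δ : Matrix (Fin 2) (Fin 2) ℂ)
    (hX : (fromBlocks 1 1 (I • 1) (-(I • 1)) * fromBlocks α β γ δ * ((2 : ℂ)⁻¹ • fromBlocks 1 (-(I • 1)) 1 (I • 1)) : Matrix (Fin 2 ⊕ Fin 2) (Fin 2 ⊕ Fin 2) ℂ)ᴴ *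
        Matrix.J (Fin 2) ℂ + Matrix.J (Fin 2) ℂ * (fromBlocks 1 1 (I • 1) (-(I • 1)) * fromBlocks α β γ δ * ((2 : ℂ)⁻¹ • fromBlocks 1 (-(I • 1)) 1 (I • 1))) = 0) :
    HasDerivAt (fun t : ℝ => A (((2 : ℂ)⁻¹ • fromBlocks (1 + u) (-(I • (1 - u))) (I • (1 - u)) (1 + u) : Matrix (Fin 2 ⊕ Fin 2) (Fin 2 ⊕ Fin 2) ℂ) *
        exp (t • (fromBlocks 1 1 (I • 1) (-(I • 1)) * fromBlocks α β γ δ * ((2 : ℂ)⁻¹ • fromBlocks 1 (-(I • 1)) 1 (I • 1)) : Matrix (Fin 2 ⊕ Fin 2) (Fin 2 ⊕ Fin 2) ℂ))))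
      (evalAt u hu' (∑ a : Fin 2, ∑ b : Fin 2, β a b • pOp pd uMat dInv (-(((k : ℂ) - 2 * s - 2) / 2)) a b P +
          ∑ a : Fin 2, ∑ b : Fin 2, γ a b • mOp pd uMat (-(((k : ℂ) - 2 * s - 2) / 2 - k)) a b P +
          ((((k : ℂ) - 2 * s - 2) / 2 - k - ((k : ℂ) - 2 * s - 2) / 2) * α.trace) • P -
          ∑ a : Fin 2, ∑ b : Fin 2, α a b • lOp pd uMat a b P + ∑ a : Fin 2, ∑ b : Fin 2, δ a b • rOp pd uMat a b P)) 0 := by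
  set X : Matrix (Fin 2 ⊕ Fin 2) (Fin 2 ⊕ Fin 2) ℂ := fromBlocks 1 1 (I • 1) (-(I • 1)) * fromBlocks α β γ δ * ((2 : ℂ)⁻¹ • fromBlocks 1 (-(I • 1)) 1 (I • 1)) with hXdef
  set kU : Matrix (Fin 2 ⊕ Fin 2) (Fin 2 ⊕ Fin 2) ℂ := (2 : ℂ)⁻¹ • fromBlocks (1 + u) (-(I • (1 - u))) (I • (1 - u)) (1 + u) with hkU
  have hXt : ∀ t : ℝ, (exp (t • X))ᴴ * Matrix.J (Fin 2) ℂ * exp (t • X) = Matrix.J (Fin 2) ℂ := conjTranspose_exp_mul_J_mul_exp hX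
  -- the Shilov coordinate curve `v_t` of `k_u · exp(tX)`: unitary, hence invertible, at every `t`
  set v : ℝ → Matrix (Fin 2) (Fin 2) ℂ := fun t =>
    (denom (kU * exp (t • X)) (-(I • (1 : Matrix (Fin 2) (Fin 2) ℂ))))⁻¹ * denom (kU * exp (t • X)) (I • (1 : Matrix (Fin 2) (Fin 2) ℂ)) with hv
  have hmem : ∀ t : ℝ, (kU * exp (t • X))ᴴ * Matrix.J (Fin 2) ℂ * (kU * exp (t • X)) = Matrix.J (Fin 2) ℂ := fun t => mul_mem_UJ (kU_mem_UJ hu) (hXt t)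
  have hvu : ∀ t : ℝ, (v t)ᴴ * v t = 1 := fun t => conjTranspose_shilov_mul (hmem t)
  have hvdet : ∀ t : ℝ, (v t).det ≠ 0 := fun t => by
    intro h0
    have h := congrArg Matrix.det (hvu t)
    rw [Matrix.det_mul, h0, mul_zero, Matrix.det_one] at h
    exact zero_ne_one h
  have hv0 : v 0 = u := by
    simp only [hv, zero_smul, NormedSpace.exp_zero, Matrix.mul_one]
    rw [hkU, denom_kU_negI, denom_kU_I, inv_one, Matrix.one_mul]
  -- the compact picture along `v_t` is `ev_{v_t} P`; K-3 differentiates it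
  have hG := hasDerivAt_evalAt v (fun i j => (denom (kU * X) (I • (1 : Matrix (Fin 2) (Fin 2) ℂ)) - denom (kU * X) (-(I • (1 : Matrix (Fin 2) (Fin 2) ℂ))) * u) i j)
    0 (fun i j => hasDerivAt_shilov_kU_exp_entry hu X i j) hvdet P
  have hfun : (fun t : ℝ => A ((2 : ℂ)⁻¹ • fromBlocks (1 + v t) (-(I • (1 - v t))) (I • (1 - v t)) (1 + v t))) = fun t => evalAt (v t) (hvdet t) P :=
    funext fun t => hAP (v t) (hvu t) (hvdet t)
  have hG' : HasDerivAt (fun t : ℝ => A ((2 : ℂ)⁻¹ • fromBlocks (1 + v t) (-(I • (1 - v t))) (I • (1 - v t)) (1 + v t)))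
      (∑ i : Fin 2, ∑ j : Fin 2, evalAt (v 0) (hvdet 0) (pd i j P) *
        (denom (kU * X) (I • (1 : Matrix (Fin 2) (Fin 2) ℂ)) - denom (kU * X) (-(I • (1 : Matrix (Fin 2) (Fin 2) ℂ))) * u) i j) 0 := by
    rw [hfun]; exact hG
  have hmain := hasDerivAt_section_kU_exp k s hA hu X hXt hG'
  refine hmain.congr_deriv ?_
  -- `θX = X` for `X ∈ 𝔲(J)`; the point `v 0 = u`; then the dictionary identity
  have hθ : Matrix.J (Fin 2) ℂ * Xᴴ * Matrix.J (Fin 2) ℂ = X := J_mul_conjTranspose_mul_J_of_mem hX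
  have hid := dictionary_identity (((k : ℂ) - 2 * s - 2) / 2 - k) (((k : ℂ) - 2 * s - 2) / 2) hu hu' α β γ δ P
  rw [hθ] at hid
  rw [hAP u hu hu', ← hid]
  simp only [hv0, Fintype.card_fin, Nat.cast_ofNat]
  congr 1
  refine Finset.sum_congr rfl fun i _ => Finset.sum_congr rfl fun j _ => ?_
  exact mul_comm _ _

/-- **THE SAME WITH THE PARAMETERS OF RECORD**: `p = s + 1 + κ∕2`, `q = s + 1 − κ∕2`, scalar `κ·tr α`, `κ = −k` (ref1 PREP-S2 §1; at `s = ½`, `κ = 2c₁+1`: `p = c₁ + 2`, `q = 1 − c₁` —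
the parameters of ★ S2-C `forall_kType_le_of_anchors`). [cite: LeeZhu1998, p. 5032] -/
theorem hasDerivAt_section_kU_exp_evalAt' (k : ℤ) (s : ℂ) {A : Matrix (Fin 2 ⊕ Fin 2) (Fin 2 ⊕ Fin 2) ℂ → ℂ}
    (hA : IsArchSiegelSection (fun z : ℂ => (conj z / ((‖z‖ : ℝ) : ℂ)) ^ k) s A) (P : Carrier)
    (hAP : ∀ (v : Matrix (Fin 2) (Fin 2) ℂ), vᴴ * v = 1 → ∀ hv : v.det ≠ 0,
      A ((2 : ℂ)⁻¹ • fromBlocks (1 + v) (-(I • (1 - v))) (I • (1 - v)) (1 + v)) = evalAt v hv P)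
    {u : Matrix (Fin 2) (Fin 2) ℂ} (hu : uᴴ * u = 1) (hu' : u.det ≠ 0) (α β γ δ : Matrix (Fin 2) (Fin 2) ℂ)
    (hX : (fromBlocks 1 1 (I • 1) (-(I • 1)) * fromBlocks α β γ δ * ((2 : ℂ)⁻¹ • fromBlocks 1 (-(I • 1)) 1 (I • 1)) : Matrix (Fin 2 ⊕ Fin 2) (Fin 2 ⊕ Fin 2) ℂ)ᴴ *
        Matrix.J (Fin 2) ℂ + Matrix.J (Fin 2) ℂ * (fromBlocks 1 1 (I • 1) (-(I • 1)) * fromBlocks α β γ δ * ((2 : ℂ)⁻¹ • fromBlocks 1 (-(I • 1)) 1 (I • 1))) = 0) :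
    HasDerivAt (fun t : ℝ => A (((2 : ℂ)⁻¹ • fromBlocks (1 + u) (-(I • (1 - u))) (I • (1 - u)) (1 + u) : Matrix (Fin 2 ⊕ Fin 2) (Fin 2 ⊕ Fin 2) ℂ) *
        exp (t • (fromBlocks 1 1 (I • 1) (-(I • 1)) * fromBlocks α β γ δ * ((2 : ℂ)⁻¹ • fromBlocks 1 (-(I • 1)) 1 (I • 1)) : Matrix (Fin 2 ⊕ Fin 2) (Fin 2 ⊕ Fin 2) ℂ))))
      (evalAt u hu' (∑ a : Fin 2, ∑ b : Fin 2, β a b • pOp pd uMat dInv (s + 1 + (-(k : ℂ)) / 2) a b P +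
          ∑ a : Fin 2, ∑ b : Fin 2, γ a b • mOp pd uMat (s + 1 - (-(k : ℂ)) / 2) a b P + ((-(k : ℂ)) * α.trace) • P -
          ∑ a : Fin 2, ∑ b : Fin 2, α a b • lOp pd uMat a b P + ∑ a : Fin 2, ∑ b : Fin 2, δ a b • rOp pd uMat a b P)) 0 := by
  have h := hasDerivAt_section_kU_exp_evalAt k s hA P hAP hu hu' α β γ δ hX
  have hp : (-(((k : ℂ) - 2 * s - 2) / 2)) = s + 1 + (-(k : ℂ)) / 2 := by ring
  have hq : (-(((k : ℂ) - 2 * s - 2) / 2 - k)) = s + 1 - (-(k : ℂ)) / 2 := by ring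
  have hκ : (((k : ℂ) - 2 * s - 2) / 2 - k - ((k : ℂ) - 2 * s - 2) / 2) = -(k : ℂ) := by ring
  rw [hp, hq, hκ] at h
  exact h

end Summit.HodgeConjecture.HodgeConjecture.Cruxes.HLiu418.K2LiuU22CompactPictureOperatorDictionary

end
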